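import Mathlib
import HarnessLib
import Literature.NumberTheory.Sieve.BatemanHorn

/-!
# Stub E3 `stub_localRootBound` of line `euler-species-factorisation` — which hypotheses are load-bearing

Refuter facts (drefute gen 4, 2026-08-16) for stub E3 of the checked skeleton
`Cruxes/SystemZeroRepulsion/Lines/euler-species-factorisation.lean` (lead seat b) of the crux
`Summit.Parity.BatemanHorn.Theses.AlmostPrimeZeros.SystemZeroRepulsion` (stmt-Parity-11291):

  E3  `∀ p D (e : ℕ → ℕ), 1 ≤ D → 8D ≤ p → (∀ n < p², e n ≤ 2) → #{n < p² : e n ≠ 0} ≤ D·p → #{n < p² : e n = 2} ≤ D →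
       T(Σ_{n<p²} X^{e n}) ≤ 128·D²/p²`,   `T(P) = Σ_{ρ ∈ roots P} ‖1 − ρ‖⁻²` (with multiplicity).

E3 is TRUE as typed (pure algebra: `E = c₀ + c₁X + c₂X²`, `c₀ ≥ 7p²/8`, every root has `|ρ| > p/(4D) ≥ 2`;
an exhaustive scan of all admissible coefficient profiles for `8 ≤ p ≤ 80` gives worst `T·p²/(128D²) = 1/64`, the sharp
value being `max T·p²/D² = 2` at `E = (p²−1) + X²`).  Of its five hypotheses, `1 ≤ D` and `8·D ≤ p` are REDUNDANT
(a polynomial of degree `≤ 2` with non-negative coefficients has all roots in `Re ρ ≤ 0`, so `T ≤ 2 < 128D²/p²` once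
`p < 8D`; `D = 0` or `p = 0` degenerate to `0 ≤ 0`) — recorded here as prose only, since the strengthened statement is
the prover's to land.  The other three ARE load-bearing, by the explicit witnesses below (all with `1 ≤ D`, `8D ≤ p`):

* without the cap `e ≤ 2`:            `p = 65, D = 1, e = 4·𝟙_{n<65}`:  `E = 65·(X⁴ + 64)`, roots `±2 ± 2i`,
                                       `T = 2/5 + 2/13 = 36/65 > 128/65²`            (`stubLocalRootBound_false_without_cap`);
* without the support count `≤ D·p`:  `p = 16, D = 1, e = 𝟙_{n ≥ 1}`:   `E = 1 + 255·X`, root `−1/255`,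
                                       `T = (255/256)² > 128/16² = 1/2`              (`stubLocalRootBound_false_without_supportCount`);
* without the two-count `≤ D`:        `p = 145, D = 1, e = 2·𝟙_{n<145}`: `E = 145·(X² + 144)`, roots `±12i`,
                                       `T = 2/145 > 128/145²`                        (`stubLocalRootBound_false_without_twoCount`).

So a proof of E3 must consume the cap, the support count and the two-count, and may ignore `1 ≤ D`, `8D ≤ p`.
-/

noncomputable section

open Polynomial Finset Complex

namespace Summit.Parity.BatemanHorn.Theorems.SystemZeroRepulsion.Negative

/-! ## Bookkeeping: the shape `Σ_{n < N} X^{e n}` for a two-valued profile -/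

/-- `{n < N : n < M} = {n < M}` for `M ≤ N`. [folklore] -/
theorem filter_range_lt_eq (N M : ℕ) (h : M ≤ N) :
    (Finset.range N).filter (fun n : ℕ => n < M) = Finset.range M := by
  ext n
  simp only [Finset.mem_filter, Finset.mem_range]
  omega

/-- `#{n < N : ¬ n < M} = N − M` for `M ≤ N`. [folklore] -/
theorem card_filter_range_not_lt (N M : ℕ) (h : M ≤ N) :
    ((Finset.range N).filter (fun n : ℕ => ¬ n < M)).card = N - M := by
  have hsum := Finset.card_filter_add_card_filter_not (s := Finset.range N) (fun n : ℕ => n < M)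
  rw [filter_range_lt_eq N M h, Finset.card_range, Finset.card_range] at hsum
  omega

/-- The generating polynomial of the two-valued profile `e = a·𝟙_{n<M} + b·𝟙_{n≥M}` on `range N`. [folklore] -/
theorem sum_range_X_pow_ite (N M a b : ℕ) (h : M ≤ N) :
    (∑ n ∈ Finset.range N, (X : ℂ[X]) ^ (if n < M then a else b)) =
      (M : ℂ[X]) * X ^ a + ((N - M : ℕ) : ℂ[X]) * X ^ b := by
  have hite : ∀ n : ℕ, (X : ℂ[X]) ^ (if n < M then a else b) = if n < M then X ^ a else X ^ b := by
    intro n; split_ifs <;> rfl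
  simp_rw [hite]
  rw [Finset.sum_ite, Finset.sum_const, Finset.sum_const, filter_range_lt_eq N M h, Finset.card_range,
    card_filter_range_not_lt N M h, nsmul_eq_mul, nsmul_eq_mul]

/-- The zero functional of an explicit product `c · ∏_{a ∈ s} (X − a)`, `c ≠ 0`: `T = Σ_{a ∈ s} ‖1 − a‖⁻²`. [folklore] -/
theorem T_C_mul_prod_X_sub_C (c : ℂ) (hc : c ≠ 0) (s : Multiset ℂ) :
    ((C c * (s.map (fun a => X - C a)).prod).roots.map (fun ρ : ℂ => (‖(1 : ℂ) - ρ‖ ^ 2)⁻¹)).sum =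
      (s.map (fun a : ℂ => (‖(1 : ℂ) - a‖ ^ 2)⁻¹)).sum := by
  rw [Polynomial.roots_C_mul _ hc, Polynomial.roots_multiset_prod_X_sub_C]

/-! ## Witness 1: the cap `e ≤ 2` is load-bearing -/

/-- `(2 + 2i)² = 8i`. [folklore] -/
theorem alpha_sq : ((2 : ℂ) + 2 * I) ^ 2 = 8 * I := by
  have h : ((2 : ℂ) + 2 * I) ^ 2 = 4 + 8 * I + 4 * I ^ 2 := by ring
  rw [h, Complex.I_sq]; ring

/-- `(2 − 2i)² = −8i`. [folklore] -/
theorem beta_sq : ((2 : ℂ) - 2 * I) ^ 2 = -(8 * I) := by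
  have h : ((2 : ℂ) - 2 * I) ^ 2 = 4 - 8 * I + 4 * I ^ 2 := by ring
  rw [h, Complex.I_sq]; ring

/-- `X⁴ + 64 = (X − α)(X + α)(X − β)(X + β)`, `α = 2+2i`, `β = 2−2i`, as a multiset product. [folklore] -/
theorem X_pow_four_add_64 :
    (X : ℂ[X]) ^ 4 + C (64 : ℂ) =
      ((({(2 : ℂ) + 2 * I, -((2 : ℂ) + 2 * I), (2 : ℂ) - 2 * I, -((2 : ℂ) - 2 * I)} : Multiset ℂ).map
        (fun a => X - C a)).prod) := by
  simp only [Multiset.insert_eq_cons, Multiset.map_cons, Multiset.prod_cons, Multiset.map_singleton,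
    Multiset.prod_singleton]
  have key : ∀ a : ℂ, (X - C a) * (X - C (-a)) = (X : ℂ[X]) ^ 2 - C (a ^ 2) := by
    intro a; rw [C_neg, C_pow]; ring
  have hprod : (8 * I) * (-(8 * I)) = (64 : ℂ) := by
    have : (8 * I) * (-(8 * I)) = -64 * I ^ 2 := by ring
    rw [this, Complex.I_sq]; ring
  calc (X : ℂ[X]) ^ 4 + C (64 : ℂ)
      = ((X : ℂ[X]) ^ 2 - C (8 * I)) * ((X : ℂ[X]) ^ 2 - C (-(8 * I))) := by
          have h2 : ((X : ℂ[X]) ^ 2 - C (8 * I)) * ((X : ℂ[X]) ^ 2 - C (-(8 * I))) =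
              (X : ℂ[X]) ^ 4 - C (8 * I + -(8 * I)) * X ^ 2 + C ((8 * I) * -(8 * I)) := by
            simp only [map_add, map_mul, map_neg]; ring
          rw [h2, hprod, add_neg_cancel, C_0]; ring
    _ = ((X - C ((2 : ℂ) + 2 * I)) * (X - C (-((2 : ℂ) + 2 * I)))) *
          ((X - C ((2 : ℂ) - 2 * I)) * (X - C (-((2 : ℂ) - 2 * I)))) := by
          rw [key, key, alpha_sq, beta_sq]
    _ = _ := by ring

/-- Witness profile 1: `e = 4` on `n < 65`, else `0`; its polynomial on `range 65²` is `65·(X⁴ + 64)`. [folklore] -/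
theorem witness_cap_poly :
    (∑ n ∈ Finset.range (65 ^ 2), (X : ℂ[X]) ^ (if n < 65 then 4 else 0)) =
      C (65 : ℂ) * ((({(2 : ℂ) + 2 * I, -((2 : ℂ) + 2 * I), (2 : ℂ) - 2 * I, -((2 : ℂ) - 2 * I)} : Multiset ℂ).map
        (fun a => X - C a)).prod) := by
  rw [← X_pow_four_add_64, sum_range_X_pow_ite (65 ^ 2) 65 4 0 (by norm_num)]
  have h1 : ((65 ^ 2 - 65 : ℕ) : ℂ[X]) = C (65 : ℂ) * C (64 : ℂ) := by
    rw [← C_mul, ← Polynomial.C_eq_natCast]; norm_num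
  rw [h1, show ((65 : ℕ) : ℂ[X]) = C (65 : ℂ) from (map_natCast C 65).symm]
  ring

/-- The zero functional of witness 1 is `2/5 + 2/13`. [folklore] -/
theorem witness_cap_T :
    ((∑ n ∈ Finset.range (65 ^ 2), (X : ℂ[X]) ^ (if n < 65 then 4 else 0)).roots.map
        (fun ρ : ℂ => (‖(1 : ℂ) - ρ‖ ^ 2)⁻¹)).sum = 2 / 5 + 2 / 13 := by
  rw [witness_cap_poly, T_C_mul_prod_X_sub_C _ (by norm_num)]
  simp only [Multiset.insert_eq_cons, Multiset.map_cons, Multiset.sum_cons, Multiset.map_singleton,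
    Multiset.sum_singleton, Complex.sq_norm, Complex.normSq_apply]
  simp
  norm_num

/-- **E3 without the cap `e ≤ 2` is FALSE** (witness `p = 65`, `D = 1`, `e = 4·𝟙_{n<65}`:
`T = 36/65 > 128/65²`; the other four hypotheses hold: `1 ≤ 1`, `8 ≤ 65`, `#{e ≠ 0} = 65 ≤ 65`, `#{e = 2} = 0 ≤ 1`). [folklore] -/
theorem stubLocalRootBound_false_without_cap :
    ¬ (∀ (p D : ℕ) (e : ℕ → ℕ), 1 ≤ D → 8 * D ≤ p →
      ((Finset.range (p ^ 2)).filter (fun n : ℕ => e n ≠ 0)).card ≤ D * p →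
      ((Finset.range (p ^ 2)).filter (fun n : ℕ => e n = 2)).card ≤ D →
      ((∑ n ∈ Finset.range (p ^ 2), (Polynomial.X : Polynomial ℂ) ^ (e n)).roots.map
          (fun ρ : ℂ => (‖(1 : ℂ) - ρ‖ ^ 2)⁻¹)).sum ≤ 128 * (D : ℝ) ^ 2 / (p : ℝ) ^ 2) := by
  intro h
  have hne : ((Finset.range (65 ^ 2)).filter (fun n : ℕ => (if n < 65 then 4 else 0) ≠ 0)).card ≤ 1 * 65 := by
    have : (Finset.range (65 ^ 2)).filter (fun n : ℕ => (if n < 65 then 4 else 0) ≠ 0) = Finset.range 65 := by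
      ext n; simp only [Finset.mem_filter, Finset.mem_range, ne_eq, ite_eq_right_iff]; omega
    rw [this, Finset.card_range]
  have htwo : ((Finset.range (65 ^ 2)).filter (fun n : ℕ => (if n < 65 then 4 else 0) = 2)).card ≤ 1 := by
    have h0 : (Finset.range (65 ^ 2)).filter (fun n : ℕ => (if n < 65 then 4 else 0) = 2) = ∅ :=
      Finset.filter_eq_empty_iff.mpr (fun n _ => by split_ifs <;> decide)
    rw [h0, Finset.card_empty]; exact Nat.zero_le _
  have hT := h 65 1 (fun n => if n < 65 then 4 else 0) le_rfl (by norm_num) hne htwo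
  rw [witness_cap_T] at hT
  norm_num at hT

/-! ## Witness 2: the support count `#{e ≠ 0} ≤ D·p` is load-bearing -/

/-- Witness profile 2: `e = 0` at `n = 0`, `e = 1` on `1 ≤ n < 256`; its polynomial is `255·(X − (−1/255))`. [folklore] -/
theorem witness_support_poly :
    (∑ n ∈ Finset.range (16 ^ 2), (X : ℂ[X]) ^ (if n < 1 then 0 else 1)) =
      C (255 : ℂ) * ((({-(1 / 255 : ℂ)} : Multiset ℂ).map (fun a => X - C a)).prod) := by
  rw [sum_range_X_pow_ite (16 ^ 2) 1 0 1 (by norm_num)]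
  simp only [Multiset.map_singleton, Multiset.prod_singleton, C_neg, sub_neg_eq_add, pow_zero, pow_one,
    mul_one, Nat.cast_one]
  rw [show ((16 ^ 2 - 1 : ℕ) : ℂ[X]) = C (255 : ℂ) by rw [← Polynomial.C_eq_natCast]; norm_num, mul_add, ← C_mul]
  norm_num
  rw [add_comm]

/-- The zero functional of witness 2 is `(255/256)²`. [folklore] -/
theorem witness_support_T :
    ((∑ n ∈ Finset.range (16 ^ 2), (X : ℂ[X]) ^ (if n < 1 then 0 else 1)).roots.map
        (fun ρ : ℂ => (‖(1 : ℂ) - ρ‖ ^ 2)⁻¹)).sum = (255 / 256) ^ 2 := by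
  rw [witness_support_poly, T_C_mul_prod_X_sub_C _ (by norm_num)]
  simp only [Multiset.map_singleton, Multiset.sum_singleton, Complex.sq_norm, Complex.normSq_apply]
  simp
  norm_num

/-- **E3 without the support count `#{e ≠ 0} ≤ D·p` is FALSE** (witness `p = 16`, `D = 1`, `e = 𝟙_{n≥1}`:
`T = (255/256)² > 128/256`; the other four hypotheses hold: `1 ≤ 1`, `8 ≤ 16`, `e ≤ 2`, `#{e = 2} = 0 ≤ 1`). [folklore] -/
theorem stubLocalRootBound_false_without_supportCount :
    ¬ (∀ (p D : ℕ) (e : ℕ → ℕ), 1 ≤ D → 8 * D ≤ p →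
      (∀ n ∈ Finset.range (p ^ 2), e n ≤ 2) →
      ((Finset.range (p ^ 2)).filter (fun n : ℕ => e n = 2)).card ≤ D →
      ((∑ n ∈ Finset.range (p ^ 2), (Polynomial.X : Polynomial ℂ) ^ (e n)).roots.map
          (fun ρ : ℂ => (‖(1 : ℂ) - ρ‖ ^ 2)⁻¹)).sum ≤ 128 * (D : ℝ) ^ 2 / (p : ℝ) ^ 2) := by
  intro h
  have hcap : ∀ n ∈ Finset.range (16 ^ 2), (if n < 1 then 0 else 1) ≤ 2 := by
    intro n _; split_ifs <;> omega
  have htwo : ((Finset.range (16 ^ 2)).filter (fun n : ℕ => (if n < 1 then 0 else 1) = 2)).card ≤ 1 := by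
    have h0 : (Finset.range (16 ^ 2)).filter (fun n : ℕ => (if n < 1 then 0 else 1) = 2) = ∅ :=
      Finset.filter_eq_empty_iff.mpr (fun n _ => by split_ifs <;> decide)
    rw [h0, Finset.card_empty]; exact Nat.zero_le _
  have hT := h 16 1 (fun n => if n < 1 then 0 else 1) le_rfl (by norm_num) hcap htwo
  rw [witness_support_T] at hT
  norm_num at hT

/-! ## Witness 3: the two-count `#{e = 2} ≤ D` is load-bearing -/

/-- `X² + 144 = (X − 12i)(X + 12i)` as a multiset product. [folklore] -/
theorem X_sq_add_144 :
    (X : ℂ[X]) ^ 2 + C (144 : ℂ) =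
      ((({(12 : ℂ) * I, -((12 : ℂ) * I)} : Multiset ℂ).map (fun a => X - C a)).prod) := by
  simp only [Multiset.insert_eq_cons, Multiset.map_cons, Multiset.prod_cons, Multiset.map_singleton,
    Multiset.prod_singleton]
  have hsq : ((12 : ℂ) * I) ^ 2 = -144 := by
    have : ((12 : ℂ) * I) ^ 2 = 144 * I ^ 2 := by ring
    rw [this, Complex.I_sq]; ring
  have key : (X - C ((12 : ℂ) * I)) * (X - C (-((12 : ℂ) * I))) = (X : ℂ[X]) ^ 2 - C (((12 : ℂ) * I) ^ 2) := by
    rw [C_neg, C_pow]; ring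
  rw [key, hsq, C_neg, sub_neg_eq_add]

/-- Witness profile 3: `e = 2` on `n < 145`, else `0`; its polynomial on `range 145²` is `145·(X² + 144)`. [folklore] -/
theorem witness_two_poly :
    (∑ n ∈ Finset.range (145 ^ 2), (X : ℂ[X]) ^ (if n < 145 then 2 else 0)) =
      C (145 : ℂ) * ((({(12 : ℂ) * I, -((12 : ℂ) * I)} : Multiset ℂ).map (fun a => X - C a)).prod) := by
  rw [← X_sq_add_144, sum_range_X_pow_ite (145 ^ 2) 145 2 0 (by norm_num)]
  have h1 : ((145 ^ 2 - 145 : ℕ) : ℂ[X]) = C (145 : ℂ) * C (144 : ℂ) := by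
    rw [← C_mul, ← Polynomial.C_eq_natCast]; norm_num
  rw [h1, show ((145 : ℕ) : ℂ[X]) = C (145 : ℂ) from (map_natCast C 145).symm]
  ring

/-- The zero functional of witness 3 is `2/145`. [folklore] -/
theorem witness_two_T :
    ((∑ n ∈ Finset.range (145 ^ 2), (X : ℂ[X]) ^ (if n < 145 then 2 else 0)).roots.map
        (fun ρ : ℂ => (‖(1 : ℂ) - ρ‖ ^ 2)⁻¹)).sum = 2 / 145 := by
  rw [witness_two_poly, T_C_mul_prod_X_sub_C _ (by norm_num)]
  simp only [Multiset.insert_eq_cons, Multiset.map_cons, Multiset.sum_cons, Multiset.map_singleton,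
    Multiset.sum_singleton, Complex.sq_norm, Complex.normSq_apply]
  simp
  norm_num

/-- **E3 without the two-count `#{e = 2} ≤ D` is FALSE** (witness `p = 145`, `D = 1`, `e = 2·𝟙_{n<145}`:
`T = 2/145 > 128/145²`; the other four hypotheses hold: `1 ≤ 1`, `8 ≤ 145`, `e ≤ 2`, `#{e ≠ 0} = 145 ≤ 145`). [folklore] -/
theorem stubLocalRootBound_false_without_twoCount :
    ¬ (∀ (p D : ℕ) (e : ℕ → ℕ), 1 ≤ D → 8 * D ≤ p →
      (∀ n ∈ Finset.range (p ^ 2), e n ≤ 2) →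
      ((Finset.range (p ^ 2)).filter (fun n : ℕ => e n ≠ 0)).card ≤ D * p →
      ((∑ n ∈ Finset.range (p ^ 2), (Polynomial.X : Polynomial ℂ) ^ (e n)).roots.map
          (fun ρ : ℂ => (‖(1 : ℂ) - ρ‖ ^ 2)⁻¹)).sum ≤ 128 * (D : ℝ) ^ 2 / (p : ℝ) ^ 2) := by
  intro h
  have hcap : ∀ n ∈ Finset.range (145 ^ 2), (if n < 145 then 2 else 0) ≤ 2 := by
    intro n _; split_ifs <;> omega
  have hne : ((Finset.range (145 ^ 2)).filter (fun n : ℕ => (if n < 145 then 2 else 0) ≠ 0)).card ≤ 1 * 145 := by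
    have : (Finset.range (145 ^ 2)).filter (fun n : ℕ => (if n < 145 then 2 else 0) ≠ 0) = Finset.range 145 := by
      ext n; simp only [Finset.mem_filter, Finset.mem_range, ne_eq, ite_eq_right_iff]; omega
    rw [this, Finset.card_range]
  have hT := h 145 1 (fun n => if n < 145 then 2 else 0) le_rfl (by norm_num) hcap hne
  rw [witness_two_T] at hT
  norm_num at hT

end Summit.Parity.BatemanHorn.Theorems.SystemZeroRepulsion.Negative
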